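import Summits.AtomisticToContinuum.FouriersLaw.Theorems.LinearSpread.Negative.LacunarySpread
import HarnessLib

/-!
# `LinearSpread` / Negative (3b): the super-lacunary spectrum — no linear lower envelope, oscillating Abel means

Support file (`--supports stmt-AtomisticToContinuum-15382`) of the crux disprover of
`Summit.AtomisticToContinuum.FouriersLaw.Theses.CoercivePulse.LinearSpread`; second half of
`LacunarySpread.lean` (the super-lacunary measure `ρ = Σₙ (4pₙ)⁻¹ δ_{1/pₙ}`, `pₙ = 2^(2ⁿ)`, its heat variance
`V(τ) = Σₙ (pₙ/2)(1 - cos(τ/pₙ))`, CEILING `V ≤ 4(1+τ)`, IO `V(πp_N) ≥ p_N`, DIPS `V(2πp_N) ≤ 20`).  Here: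

* §4 `V` as a function: `≥ 0`, continuity of the series (locally uniform convergence), Laplace integrability of
  `e^{-νt}V` (from the ceiling), and the packaged ceiling / IO / no-envelope statements for the `V` of `ρ`;
* §5 `not_linearEnvelope_of_io_and_ceiling` — "finite spectral measure + linear ceiling + infinitely-often linear
  growth ⇒ eventual linear lower envelope" is FALSE: at the level of positive-type kernels IO ∧ `LinearCeiling` ⇏
  `LinearSpread`, so the line `KaramataCollapse` cannot drop `stub_abelRegularity` and a proof of the crux along it
  must use zero-frequency NON-OSCILLATION of the current spectral measure;
  `stub_karamataCollapse_false_without_abel` — the registered stub K with its Abel hypothesis deleted (everything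
  else verbatim) is FALSE (witness `f = V`, `σ = √V`; increments = the landed stub I);
  `superlacunary_abelMeans_oscillate` — read through the landed K, `ν²∫₀^∞e^{-νt}V` (twice the Poisson means of
  `ρ`) neither converges nor tends to `+∞` as `ν ↓ 0`: an explicit enemy with `LinearCeiling`-shape and IO TRUE,
  `LinearSpread`- and `AbelRegularity`-shape FALSE.

No new definitions.  refuter-cdisprove-stmt-AtomisticToContinuum-15382-0, 2026-08-17.
-/

noncomputable section

namespace Summit.AtomisticToContinuum.FouriersLaw.Theorems.LinearSpread.Negative

open MeasureTheory Set Filter Topology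
open scoped BigOperators
open Summit.AtomisticToContinuum.FouriersLaw.Theorems.UnboundedHeatVariance.Negative

/-! ## §4 The heat variance of `ρ` as a function: non-negativity, continuity, Laplace integrability -/

/-- Continuity of `τ ↦ Σₙ (pₙ/2)(1 - cos(τ/pₙ))` on `ℝ` (locally uniform convergence: on `(-R, R)` the terms are
`≤ R²/(4pₙ)`). [folklore] -/
theorem continuous_superlacunary_tsum :
    Continuous fun τ : ℝ => ∑' n : ℕ, (2:ℝ) ^ (2 ^ n) / 2 * (1 - Real.cos (((2:ℝ) ^ (2 ^ n))⁻¹ * τ)) := by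
  refine continuous_iff_continuousAt.2 fun τ₀ => ?_
  set R : ℝ := |τ₀| + 1 with hR
  have hon : ContinuousOn
      (fun τ : ℝ => ∑' n : ℕ, (2:ℝ) ^ (2 ^ n) / 2 * (1 - Real.cos (((2:ℝ) ^ (2 ^ n))⁻¹ * τ))) (Ioo (-R) R) := by
    refine continuousOn_tsum (fun n => (by fun_prop : Continuous fun τ : ℝ =>
        (2:ℝ) ^ (2 ^ n) / 2 * (1 - Real.cos (((2:ℝ) ^ (2 ^ n))⁻¹ * τ))).continuousOn)
      (summable_inv_superlacunary.mul_left (R ^ 2 / 4)) fun n τ hτ => ?_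
    rw [Real.norm_eq_abs, abs_of_nonneg (superlacunary_term_nonneg n τ)]
    refine (superlacunary_term_le_sq n τ).trans ?_
    have hτ2 : τ ^ 2 ≤ R ^ 2 := by
      apply sq_le_sq'
      · linarith [hτ.1]
      · linarith [hτ.2]
    have hp : (0:ℝ) ≤ ((2:ℝ) ^ (2 ^ n))⁻¹ := by positivity
    nlinarith
  exact hon.continuousAt (Ioo_mem_nhds (by linarith [neg_abs_le τ₀]) (by linarith [le_abs_self τ₀]))

/-- The heat variance of `ρ` is `≥ 0` on `τ ≥ 0`. [folklore] -/
theorem superlacunary_heatVariance_nonneg {ρ : Measure ℝ}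
    (hρ : ρ = Measure.sum (fun n : ℕ =>
      ENNReal.ofReal (((2:ℝ) ^ (2 ^ n))⁻¹ / 4) • Measure.dirac (((2:ℝ) ^ (2 ^ n))⁻¹)))
    {V : ℝ → ℝ} (hV : V = fun τ : ℝ => 2 * ∫ s in Ioc (0:ℝ) τ, (τ - s) * ∫ w : ℝ, Real.cos (w * s) ∂ρ)
    {t : ℝ} (ht : 0 ≤ t) : 0 ≤ V t := by
  rw [hV]
  dsimp only
  rw [superlacunary_heatVariance_eq_tsum hρ ht]
  exact tsum_nonneg fun n => superlacunary_term_nonneg n t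

/-- **CEILING** for the heat variance of `ρ`: `V(t) ≤ 4(1+t)` on `t ≥ 0`. [folklore] -/
theorem superlacunary_heatVariance_le {ρ : Measure ℝ}
    (hρ : ρ = Measure.sum (fun n : ℕ =>
      ENNReal.ofReal (((2:ℝ) ^ (2 ^ n))⁻¹ / 4) • Measure.dirac (((2:ℝ) ^ (2 ^ n))⁻¹)))
    {V : ℝ → ℝ} (hV : V = fun τ : ℝ => 2 * ∫ s in Ioc (0:ℝ) τ, (τ - s) * ∫ w : ℝ, Real.cos (w * s) ∂ρ)
    {t : ℝ} (ht : 0 ≤ t) : V t ≤ 4 * (1 + t) := by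
  rw [hV]
  dsimp only
  rw [superlacunary_heatVariance_eq_tsum hρ ht]
  exact superlacunary_tsum_le ht

/-- **IO** for the heat variance of `ρ`: `(1/4)·t ≤ V(t)` at `t = π p_N`, and these times are unbounded. [folklore] -/
theorem superlacunary_heatVariance_io {ρ : Measure ℝ}
    (hρ : ρ = Measure.sum (fun n : ℕ =>
      ENNReal.ofReal (((2:ℝ) ^ (2 ^ n))⁻¹ / 4) • Measure.dirac (((2:ℝ) ^ (2 ^ n))⁻¹)))
    {V : ℝ → ℝ} (hV : V = fun τ : ℝ => 2 * ∫ s in Ioc (0:ℝ) τ, (τ - s) * ∫ w : ℝ, Real.cos (w * s) ∂ρ) :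
    ∃ m₀ : ℝ, 0 < m₀ ∧ ∀ t₀ : ℝ, ∃ t : ℝ, t₀ ≤ t ∧ m₀ * t ≤ V t := by
  refine ⟨1/4, by norm_num, fun t₀ => ?_⟩
  obtain ⟨N, hN⟩ := exists_nat_gt t₀
  have h1 := nat_le_superlacunary N
  have hp := superlacunary_pos N
  refine ⟨Real.pi * (2:ℝ) ^ (2 ^ N), by nlinarith [Real.pi_gt_three], ?_⟩
  rw [hV]
  dsimp only
  rw [superlacunary_heatVariance_eq_tsum hρ (by positivity)]
  have := le_superlacunary_tsum_antiphase N
  nlinarith [Real.pi_le_four]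

/-- **DIPS** for the heat variance of `ρ`: no linear lower envelope (`V(2πp_N) ≤ 20` along `N → ∞`). [folklore] -/
theorem superlacunary_heatVariance_no_envelope {ρ : Measure ℝ}
    (hρ : ρ = Measure.sum (fun n : ℕ =>
      ENNReal.ofReal (((2:ℝ) ^ (2 ^ n))⁻¹ / 4) • Measure.dirac (((2:ℝ) ^ (2 ^ n))⁻¹)))
    {V : ℝ → ℝ} (hV : V = fun τ : ℝ => 2 * ∫ s in Ioc (0:ℝ) τ, (τ - s) * ∫ w : ℝ, Real.cos (w * s) ∂ρ) :
    ¬ ∃ m t₂ : ℝ, 0 < m ∧ ∀ t : ℝ, t₂ ≤ t → m * t ≤ V t := by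
  rintro ⟨m, t₂, hm, hmt⟩
  obtain ⟨N, hN⟩ := exists_nat_gt (max t₂ (20 / m))
  have hp := superlacunary_pos N
  have hbig : (N:ℝ) ≤ 2 * Real.pi * (2:ℝ) ^ (2 ^ N) := by nlinarith [nat_le_superlacunary N, Real.pi_gt_three]
  have ht₂ : t₂ ≤ 2 * Real.pi * (2:ℝ) ^ (2 ^ N) := ((le_max_left _ _).trans hN.le).trans hbig
  have h20 : 20 / m < 2 * Real.pi * (2:ℝ) ^ (2 ^ N) := ((le_max_right _ _).trans_lt hN).trans_le hbig
  have key := hmt _ ht₂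
  rw [hV] at key
  dsimp only at key
  rw [superlacunary_heatVariance_eq_tsum hρ (by positivity)] at key
  rw [div_lt_iff₀ hm] at h20
  nlinarith [superlacunary_tsum_inphase_le N]

/-- Laplace integrability of the heat variance of `ρ`: `e^{-νt}V(t)` is integrable on `(0,∞)` for every `ν > 0`
(continuity of the series + the ceiling). [folklore] -/
theorem superlacunary_heatVariance_integrableOn {ρ : Measure ℝ}
    (hρ : ρ = Measure.sum (fun n : ℕ =>
      ENNReal.ofReal (((2:ℝ) ^ (2 ^ n))⁻¹ / 4) • Measure.dirac (((2:ℝ) ^ (2 ^ n))⁻¹)))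
    {V : ℝ → ℝ} (hV : V = fun τ : ℝ => 2 * ∫ s in Ioc (0:ℝ) τ, (τ - s) * ∫ w : ℝ, Real.cos (w * s) ∂ρ)
    {ν : ℝ} (hν : 0 < ν) : IntegrableOn (fun t : ℝ => Real.exp (-(ν * t)) * V t) (Ioi 0) := by
  set g : ℝ → ℝ := fun τ : ℝ => ∑' n : ℕ, (2:ℝ) ^ (2 ^ n) / 2 * (1 - Real.cos (((2:ℝ) ^ (2 ^ n))⁻¹ * τ)) with hg
  have hgc : Continuous g := continuous_superlacunary_tsum
  have hdom := (Summit.AtomisticToContinuum.FouriersLaw.Theorems.LinearSpread.KaramataCollapse.integral_exp_neg_mul_linear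
    hν 4).1
  have hmeas : AEStronglyMeasurable (fun t : ℝ => Real.exp (-(ν * t)) * g t) (volume.restrict (Ioi 0)) :=
    ((Real.continuous_exp.comp (continuous_const.mul continuous_id).neg).mul hgc).aestronglyMeasurable
  have h1 : IntegrableOn (fun t : ℝ => Real.exp (-(ν * t)) * g t) (Ioi 0) := by
    refine Integrable.mono' hdom hmeas ?_
    refine (ae_restrict_iff' measurableSet_Ioi).2 (Eventually.of_forall fun t ht => ?_)
    have hg0 : 0 ≤ g t := tsum_nonneg fun n => superlacunary_term_nonneg n t
    rw [Real.norm_eq_abs, abs_mul, abs_of_pos (Real.exp_pos _), abs_of_nonneg hg0]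
    exact mul_le_mul_of_nonneg_left (superlacunary_tsum_le (le_of_lt ht)) (Real.exp_pos _).le
  refine h1.congr_fun (fun t ht => ?_) measurableSet_Ioi
  simp only [hg]
  rw [hV]
  dsimp only
  rw [superlacunary_heatVariance_eq_tsum hρ (le_of_lt ht)]

/-! ## §5 The strengthenings are false; the Abel means of `ρ` oscillate -/

/-- **IO ∧ ceiling ⇏ linear lower envelope, at the spectral level.**  The natural strengthening "for every finite
measure `ρ` on `ℝ`, if its heat variance `V(τ) = 2∫_{(0,τ]}(τ-s)(∫cos(ωs)dρ)ds` has a linear ceiling and grows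
linearly infinitely often, then it has an eventual linear lower envelope" is FALSE (super-lacunary `ρ`).  Hence the
line `KaramataCollapse` cannot drop its `stub_abelRegularity`, and no proof of `LinearSpread` can run on
`LinearCeiling` + infinitely-often spread + positive type of `C_T` alone. [folklore] -/
theorem not_linearEnvelope_of_io_and_ceiling :
    ¬ (∀ ρ : MeasureTheory.Measure ℝ, MeasureTheory.IsFiniteMeasure ρ → ∀ V : ℝ → ℝ,
        V = (fun τ : ℝ => 2 * ∫ s in Set.Ioc (0:ℝ) τ, (τ - s) * ∫ w : ℝ, Real.cos (w * s) ∂ρ) →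
        (∃ b : ℝ, ∀ t : ℝ, 0 ≤ t → V t ≤ b * (1 + t)) →
        (∃ m₀ : ℝ, 0 < m₀ ∧ ∀ t₀ : ℝ, ∃ t : ℝ, t₀ ≤ t ∧ m₀ * t ≤ V t) →
        ∃ m t₂ : ℝ, 0 < m ∧ ∀ t : ℝ, t₂ ≤ t → m * t ≤ V t) := by
  intro h
  obtain ⟨ρ, hρ⟩ : ∃ ρ : Measure ℝ, ρ = Measure.sum (fun n : ℕ =>
      ENNReal.ofReal (((2:ℝ) ^ (2 ^ n))⁻¹ / 4) • Measure.dirac (((2:ℝ) ^ (2 ^ n))⁻¹)) := ⟨_, rfl⟩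
  haveI := superlacunary_isFiniteMeasure hρ
  obtain ⟨V, hV⟩ : ∃ V : ℝ → ℝ,
      V = fun τ : ℝ => 2 * ∫ s in Ioc (0:ℝ) τ, (τ - s) * ∫ w : ℝ, Real.cos (w * s) ∂ρ := ⟨_, rfl⟩
  exact superlacunary_heatVariance_no_envelope hρ hV
    (h ρ inferInstance V hV ⟨4, fun t ht => superlacunary_heatVariance_le hρ hV ht⟩
      (superlacunary_heatVariance_io hρ hV))

/-- **Stub K without Abel regularity is false.**  The registered stub `stub_karamataCollapse` of line
`KaramataCollapse` with its Abel-regularity hypothesis DELETED (all other hypotheses verbatim) fails for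
`f = V`, `σ = √V`, `V` the heat variance of the super-lacunary `ρ`: `σ ≥ 0`, the increment bound is the landed stub I
(`stub_spectralIncrements`), `f = σ²` since `V ≥ 0`, ceiling `4(1+t)`, Laplace integrability, IO with `m₀ = 1/4` —
and no eventual linear lower envelope.  So the Abel hypothesis of K is load-bearing (not an artefact of the proof
via Karamata). [folklore] -/
theorem stub_karamataCollapse_false_without_abel :
    ¬ (∀ (f σ : ℝ → ℝ), (∀ t : ℝ, 0 ≤ t → 0 ≤ σ t) →
      (∀ s t : ℝ, 0 ≤ s → s ≤ t → |σ t - σ s| ≤ σ (t - s)) →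
      (∀ t : ℝ, 0 ≤ t → f t = σ t ^ 2) →
      (∃ b : ℝ, ∀ t : ℝ, 0 ≤ t → f t ≤ b * (1 + t)) →
      (∀ ν : ℝ, 0 < ν → MeasureTheory.IntegrableOn (fun t : ℝ => Real.exp (-(ν * t)) * f t) (Set.Ioi 0)) →
      (∃ m₀ : ℝ, 0 < m₀ ∧ ∀ t₀ : ℝ, ∃ t : ℝ, t₀ ≤ t ∧ m₀ * t ≤ f t) →
      ∃ m t₂ : ℝ, 0 < m ∧ ∀ t : ℝ, t₂ ≤ t → m * t ≤ f t) := by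
  intro h
  obtain ⟨ρ, hρ⟩ : ∃ ρ : Measure ℝ, ρ = Measure.sum (fun n : ℕ =>
      ENNReal.ofReal (((2:ℝ) ^ (2 ^ n))⁻¹ / 4) • Measure.dirac (((2:ℝ) ^ (2 ^ n))⁻¹)) := ⟨_, rfl⟩
  haveI := superlacunary_isFiniteMeasure hρ
  obtain ⟨V, hV⟩ : ∃ V : ℝ → ℝ,
      V = fun τ : ℝ => 2 * ∫ s in Ioc (0:ℝ) τ, (τ - s) * ∫ w : ℝ, Real.cos (w * s) ∂ρ := ⟨_, rfl⟩
  have hinc := Summit.AtomisticToContinuum.FouriersLaw.Theorems.LinearSpread.KaramataCollapse.stub_spectralIncrements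
    ρ inferInstance V hV
  exact superlacunary_heatVariance_no_envelope hρ hV
    (h V (fun t => Real.sqrt (V t)) (fun t _ => Real.sqrt_nonneg _) hinc
      (fun t ht => (Real.sq_sqrt (superlacunary_heatVariance_nonneg hρ hV ht)).symm)
      ⟨4, fun t ht => superlacunary_heatVariance_le hρ hV ht⟩
      (fun ν hν => superlacunary_heatVariance_integrableOn hρ hV hν)
      (superlacunary_heatVariance_io hρ hV))

/-- **The Abel means of the super-lacunary heat variance oscillate.**  Read through the LANDED stub K: since every
other hypothesis of K holds for `V` and its conclusion fails, the Abel dichotomy must fail —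
`ν ↦ ν²∫₀^∞e^{-νt}V(t)dt` (twice the Poisson means `∫ ν/(ν²+ω²)dρ` of `ρ`, by `V'' = 2C`, `V(0) = V'(0) = 0`)
neither converges in `ℝ` nor tends to `+∞` as `ν ↓ 0`.  An explicit enemy of the route `CoercivePulse` at the level
of its three physics cruxes: `LinearCeiling`-shape TRUE, infinitely-often spread TRUE, `LinearSpread`-shape FALSE,
`AbelRegularity`-shape FALSE. [folklore] -/
theorem superlacunary_abelMeans_oscillate {ρ : Measure ℝ}
    (hρ : ρ = Measure.sum (fun n : ℕ =>
      ENNReal.ofReal (((2:ℝ) ^ (2 ^ n))⁻¹ / 4) • Measure.dirac (((2:ℝ) ^ (2 ^ n))⁻¹)))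
    {V : ℝ → ℝ} (hV : V = fun τ : ℝ => 2 * ∫ s in Ioc (0:ℝ) τ, (τ - s) * ∫ w : ℝ, Real.cos (w * s) ∂ρ) :
    ¬ ((∃ L : ℝ, Tendsto (fun ν : ℝ => ν ^ 2 * ∫ t in Ioi (0:ℝ), Real.exp (-(ν * t)) * V t)
          (𝓝[>] 0) (𝓝 L)) ∨
        Tendsto (fun ν : ℝ => ν ^ 2 * ∫ t in Ioi (0:ℝ), Real.exp (-(ν * t)) * V t) (𝓝[>] 0) atTop) := by
  intro habel
  haveI := superlacunary_isFiniteMeasure hρ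
  have hinc := Summit.AtomisticToContinuum.FouriersLaw.Theorems.LinearSpread.KaramataCollapse.stub_spectralIncrements
    ρ inferInstance V hV
  exact superlacunary_heatVariance_no_envelope hρ hV
    (Summit.AtomisticToContinuum.FouriersLaw.Theorems.LinearSpread.KaramataCollapse.stub_karamataCollapse
      V (fun t => Real.sqrt (V t)) (fun t _ => Real.sqrt_nonneg _) hinc
      (fun t ht => (Real.sq_sqrt (superlacunary_heatVariance_nonneg hρ hV ht)).symm)
      ⟨4, fun t ht => superlacunary_heatVariance_le hρ hV ht⟩
      (fun ν hν => superlacunary_heatVariance_integrableOn hρ hV hν) habel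
      (superlacunary_heatVariance_io hρ hV))

end Summit.AtomisticToContinuum.FouriersLaw.Theorems.LinearSpread.Negative

end
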